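import Mathlib
import HarnessLib
import Literature.LinearAlgebra.Matrix.NormalMatrixSpectralTheorem
import Literature.MathematicalPhysics.QuantumLattice.GaugeGroups
import Summits.Ventures.LatticeQCDFlow.Exactness.SubgroupProductHaar

/-!
# A function of `W ∈ SU(N)` that is a measurable function of the spectrum in every unitary diagonalization is measurable (Suslin)

HONEST FRAMING: exact (Metropolis-corrected) sampling algorithms for lattice gauge theory;
figures of merit are autocorrelation/cost numbers at stated couplings and volumes; no
continuum-physics claim.

Venture `LatticeQCDFlow` (cell pub-lqcd), topic `Exactness`; FANOUT row 10 (`eng-equiv`, engine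
`latflow.equiv` `spectral.spectral_kernel`).  NEW WORK of the cell.  Every spectral-kernel exactness
theorem of this topic (`hasJacobian_spectralKernel_…`) carries two hypotheses on the booked density
`J : SU(N) → ℝ≥0∞`: `hJspec` (in every unitary diagonalization `W = V·diag d·V⋆`, `J W = JD d`) and
`hJm : Measurable J`.  This file shows that `hJm` FOLLOWS from `hJspec` and `Measurable JD`, so the
engine's density — which is computed from the eigen-phases only — needs no separate measurability
argument.  The proof is descriptive set theory, not a formula: `J⁻¹(B)` is the image of the Borel set
`{(V, T) : T diagonal, JD(diag T) ∈ B} ⊆ SU(N) × SU(N)` under the continuous map `(V, T) ↦ V T V⁻¹`,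
hence analytic; so is its complement (`B ↦ Bᶜ`); Suslin's theorem (Mathlib
`AnalyticSet.measurableSet_of_compl`) makes it Borel.  The spectral theorem with a conjugator in
`SU(N)` is the tree's `exists_specialUnitaryGroup_forall_conj_eq_diagonal_of_commute_of_isStarNormal`.
Nothing is cited as a fact; no number; no definition.

## What is typed

* `coe_eq_diagonal_of_offDiag_eq_zero` — a matrix with vanishing off-diagonal entries is `diagonal`;
* `exists_specialUnitary_conj_diagonal` — every `W ∈ SU(N)` is `V T V⁻¹` with `V, T ∈ SU(N)`, `T` diagonal;
* `preimage_eq_image_conj_of_spectral` — `J⁻¹(B) = {V T V⁻¹ : T diagonal, JD(diag T) ∈ B}`;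
* **`measurable_of_spectral`** — `Measurable JD ∧ hJspec ⇒ Measurable J` (any measurable target);
* `exists_unitary_conj_diagonal`, `preimage_eq_image_conj_of_spectral_unitary`,
  **`measurable_of_spectral_unitary`** — the same for `U(N)`.
-/

noncomputable section

namespace Summit.Ventures.LatticeQCDFlow.Exactness

open MeasureTheory Matrix Set

variable {n : Type} [Fintype n] [DecidableEq n]

omit [Fintype n] in
/-- A square matrix whose off-diagonal entries vanish is the diagonal matrix of its diagonal. -/
theorem coe_eq_diagonal_of_offDiag_eq_zero {T : Matrix n n ℂ} (hT : ∀ i j, i ≠ j → T i j = 0) :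
    T = diagonal fun i => T i i := by
  ext i j
  by_cases hij : i = j
  · subst hij
    rw [diagonal_apply_eq]
  · rw [diagonal_apply_ne _ hij, hT i j hij]

/-- **Spectral theorem inside `SU(N)`.**  Every `W ∈ SU(N)` is `V · T · V⁻¹` with `V, T ∈ SU(N)` and
`T` diagonal; moreover `W = V · diag(T₁₁, …, T_NN) · V⋆` as matrices. -/
theorem exists_specialUnitary_conj_diagonal (W : Matrix.specialUnitaryGroup n ℂ) :
    ∃ V T : Matrix.specialUnitaryGroup n ℂ, (∀ i j, i ≠ j → (T : Matrix n n ℂ) i j = 0) ∧ W = V * T * V⁻¹ ∧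
      (W : Matrix n n ℂ) = (V : Matrix n n ℂ) * diagonal (fun i => (T : Matrix n n ℂ) i i) * star (V : Matrix n n ℂ) := by
  have hWu : (W : Matrix n n ℂ) ∈ Matrix.unitaryGroup n ℂ := (Matrix.mem_specialUnitaryGroup_iff.mp W.2).1
  have hWn : IsStarNormal (W : Matrix n n ℂ) :=
    ⟨by rw [Commute, SemiconjBy, Matrix.mem_unitaryGroup_iff'.mp hWu, Matrix.mem_unitaryGroup_iff.mp hWu]⟩
  obtain ⟨V, hV, d, hd⟩ :=
    Literature.LinearAlgebra.Matrix.exists_specialUnitaryGroup_forall_conj_eq_diagonal_of_commute_of_isStarNormal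
      (fun _ : Unit => (W : Matrix n n ℂ)) (fun _ => hWn) (fun _ _ => Commute.refl _)
  set V' : Matrix.specialUnitaryGroup n ℂ := ⟨V, hV⟩ with hV'
  set T : Matrix.specialUnitaryGroup n ℂ := V'⁻¹ * W * V' with hTdef
  have hT : (T : Matrix n n ℂ) = diagonal (d ()) := hd ()
  refine ⟨V', T, fun i j hij => by rw [hT, diagonal_apply_ne _ hij], by rw [hTdef]; group, ?_⟩
  have hdiag : (fun i => (T : Matrix n n ℂ) i i) = d () := funext fun i => by rw [hT, diagonal_apply_eq]
  rw [hdiag]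
  have hVu : V ∈ Matrix.unitaryGroup n ℂ := (Matrix.mem_specialUnitaryGroup_iff.mp hV).1
  have h2 : V * star V = 1 := Matrix.mem_unitaryGroup_iff.mp hVu
  calc (W : Matrix n n ℂ) = (V * star V) * (W : Matrix n n ℂ) * (V * star V) := by rw [h2, Matrix.one_mul, Matrix.mul_one]
    _ = V * (star V * (W : Matrix n n ℂ) * V) * star V := by simp only [Matrix.mul_assoc]
    _ = V * diagonal (d ()) * star V := by rw [hd ()]

/-- **`J⁻¹(B)` as a continuous image.**  If `J W = JD d` in every unitary diagonalization
`W = V·diag d·V⋆`, then `J⁻¹(B)` is the image of `{(V, T) : T diagonal, JD(diag T) ∈ B}` under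
`(V, T) ↦ V T V⁻¹`. -/
theorem preimage_eq_image_conj_of_spectral {β : Type*} {JD : (n → ℂ) → β}
    {J : Matrix.specialUnitaryGroup n ℂ → β}
    (hJspec : ∀ (W : Matrix.specialUnitaryGroup n ℂ) (V : Matrix n n ℂ) (d : n → ℂ),
      V ∈ Matrix.unitaryGroup n ℂ → (W : Matrix n n ℂ) = V * diagonal d * star V → J W = JD d)
    (B : Set β) :
    J ⁻¹' B = (fun p : Matrix.specialUnitaryGroup n ℂ × Matrix.specialUnitaryGroup n ℂ => p.1 * p.2 * p.1⁻¹) ''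
      {p | (∀ i j, i ≠ j → ((p.2 : Matrix.specialUnitaryGroup n ℂ) : Matrix n n ℂ) i j = 0) ∧
        JD (fun i => ((p.2 : Matrix.specialUnitaryGroup n ℂ) : Matrix n n ℂ) i i) ∈ B} := by
  ext W
  constructor
  · intro hW
    obtain ⟨V, T, hT, hWVT, hWd⟩ := exists_specialUnitary_conj_diagonal W
    refine ⟨(V, T), ⟨hT, ?_⟩, hWVT.symm⟩
    show JD (fun i => (T : Matrix n n ℂ) i i) ∈ B
    rw [← hJspec W V _ (Matrix.mem_specialUnitaryGroup_iff.mp V.2).1 hWd]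
    exact hW
  · rintro ⟨⟨V, T⟩, ⟨hT, hB⟩, rfl⟩
    show J (V * T * V⁻¹) ∈ B
    have hVu : (V : Matrix n n ℂ) ∈ Matrix.unitaryGroup n ℂ := (Matrix.mem_specialUnitaryGroup_iff.mp V.2).1
    have hcoe : (((V * T * V⁻¹ : Matrix.specialUnitaryGroup n ℂ)) : Matrix n n ℂ) =
        (V : Matrix n n ℂ) * diagonal (fun i => (T : Matrix n n ℂ) i i) * star (V : Matrix n n ℂ) := by
      rw [← coe_eq_diagonal_of_offDiag_eq_zero hT]
      rfl
    rw [hJspec _ _ _ hVu hcoe]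
    exact hB

/-- **Measurability of a spectral density.**  Let `J : SU(N) → β` (any measurable space `β`) satisfy
`J W = JD d` whenever `W = V·diag d·V⋆` with `V` unitary, for a measurable `JD : (n → ℂ) → β`.  Then `J`
is measurable.  (Removes the hypothesis `hJm` of the `hasJacobian_spectralKernel_…` theorems.) -/
theorem measurable_of_spectral {β : Type*} [MeasurableSpace β] {JD : (n → ℂ) → β} (hJDm : Measurable JD)
    {J : Matrix.specialUnitaryGroup n ℂ → β}
    (hJspec : ∀ (W : Matrix.specialUnitaryGroup n ℂ) (V : Matrix n n ℂ) (d : n → ℂ),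
      V ∈ Matrix.unitaryGroup n ℂ → (W : Matrix n n ℂ) = V * diagonal d * star V → J W = JD d) :
    Measurable J := by
  haveI : SecondCountableTopology (Matrix n n ℂ) := inferInstanceAs (SecondCountableTopology (n → n → ℂ))
  haveI : SecondCountableTopology (Matrix.specialUnitaryGroup n ℂ) :=
    Topology.IsEmbedding.subtypeVal.secondCountableTopology
  intro B hB
  -- the conjugation map and the Borel sets upstairs
  have hΨ : Continuous fun p : Matrix.specialUnitaryGroup n ℂ × Matrix.specialUnitaryGroup n ℂ => p.1 * p.2 * p.1⁻¹ :=
    (continuous_fst.mul continuous_snd).mul continuous_fst.inv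
  have hentry : ∀ i j, Continuous fun p : Matrix.specialUnitaryGroup n ℂ × Matrix.specialUnitaryGroup n ℂ =>
      ((p.2 : Matrix.specialUnitaryGroup n ℂ) : Matrix n n ℂ) i j := fun i j => by
    have h1 : Continuous fun p : Matrix.specialUnitaryGroup n ℂ × Matrix.specialUnitaryGroup n ℂ =>
        ((p.2 : Matrix.specialUnitaryGroup n ℂ) : Matrix n n ℂ) := continuous_subtype_val.comp continuous_snd
    exact (continuous_apply j).comp ((continuous_apply i).comp h1)
  have hS : ∀ C : Set β, MeasurableSet C → MeasurableSet
      {p : Matrix.specialUnitaryGroup n ℂ × Matrix.specialUnitaryGroup n ℂ |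
        (∀ i j, i ≠ j → ((p.2 : Matrix.specialUnitaryGroup n ℂ) : Matrix n n ℂ) i j = 0) ∧
          JD (fun i => ((p.2 : Matrix.specialUnitaryGroup n ℂ) : Matrix n n ℂ) i i) ∈ C} := by
    intro C hC
    have hdiag : MeasurableSet {p : Matrix.specialUnitaryGroup n ℂ × Matrix.specialUnitaryGroup n ℂ |
        ∀ i j, i ≠ j → ((p.2 : Matrix.specialUnitaryGroup n ℂ) : Matrix n n ℂ) i j = 0} := by
      have hset : {p : Matrix.specialUnitaryGroup n ℂ × Matrix.specialUnitaryGroup n ℂ |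
          ∀ i j, i ≠ j → ((p.2 : Matrix.specialUnitaryGroup n ℂ) : Matrix n n ℂ) i j = 0} =
          ⋂ i, ⋂ j, {p | i ≠ j → ((p.2 : Matrix.specialUnitaryGroup n ℂ) : Matrix n n ℂ) i j = 0} := by
        ext p
        simp only [mem_setOf_eq, mem_iInter]
      rw [hset]
      refine MeasurableSet.iInter fun i => MeasurableSet.iInter fun j => ?_
      by_cases hij : i = j
      · have h0 : {p : Matrix.specialUnitaryGroup n ℂ × Matrix.specialUnitaryGroup n ℂ |
            i ≠ j → ((p.2 : Matrix.specialUnitaryGroup n ℂ) : Matrix n n ℂ) i j = 0} = univ := by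
          ext p
          simp [hij]
        rw [h0]
        exact MeasurableSet.univ
      · have h0 : {p : Matrix.specialUnitaryGroup n ℂ × Matrix.specialUnitaryGroup n ℂ |
            i ≠ j → ((p.2 : Matrix.specialUnitaryGroup n ℂ) : Matrix n n ℂ) i j = 0} =
            {p | ((p.2 : Matrix.specialUnitaryGroup n ℂ) : Matrix n n ℂ) i j = 0} := by
          ext p
          simp [hij]
        rw [h0]
        exact (isClosed_eq (hentry i j) continuous_const).measurableSet
    rw [setOf_and]
    exact hdiag.inter ((hJDm.comp (measurable_pi_lambda _ fun i => (hentry i i).measurable)) hC)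
  -- both `J⁻¹ B` and its complement are analytic
  have hA : ∀ C : Set β, MeasurableSet C → AnalyticSet (J ⁻¹' C) := fun C hC => by
    rw [preimage_eq_image_conj_of_spectral hJspec C]
    exact (hS C hC).analyticSet_image hΨ.measurable
  exact (hA B hB).measurableSet_of_compl (by rw [← preimage_compl]; exact hA Bᶜ hB.compl)

/-! ## The same for `U(N)` -/

section Unitary

/-- **Spectral theorem inside `U(N)`.**  Every `W ∈ U(N)` is `V · T · V⁻¹` with `V, T ∈ U(N)` and `T`
diagonal; moreover `W = V · diag(T₁₁, …, T_NN) · V⋆` as matrices. -/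
theorem exists_unitary_conj_diagonal (W : Matrix.unitaryGroup n ℂ) :
    ∃ V T : Matrix.unitaryGroup n ℂ, (∀ i j, i ≠ j → (T : Matrix n n ℂ) i j = 0) ∧ W = V * T * V⁻¹ ∧
      (W : Matrix n n ℂ) = (V : Matrix n n ℂ) * diagonal (fun i => (T : Matrix n n ℂ) i i) * star (V : Matrix n n ℂ) := by
  have hWu : (W : Matrix n n ℂ) ∈ Matrix.unitaryGroup n ℂ := W.2
  have hWn : IsStarNormal (W : Matrix n n ℂ) :=
    ⟨by rw [Commute, SemiconjBy, Matrix.mem_unitaryGroup_iff'.mp hWu, Matrix.mem_unitaryGroup_iff.mp hWu]⟩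
  obtain ⟨V, hV, d, hd⟩ :=
    (Literature.LinearAlgebra.Matrix.isStarNormal_iff_exists_unitaryGroup_conj_eq_diagonal (W : Matrix n n ℂ)).mp hWn
  set V' : Matrix.unitaryGroup n ℂ := ⟨V, hV⟩ with hV'
  set T : Matrix.unitaryGroup n ℂ := V'⁻¹ * W * V' with hTdef
  have hT : (T : Matrix n n ℂ) = diagonal d := hd
  refine ⟨V', T, fun i j hij => by rw [hT, diagonal_apply_ne _ hij], by rw [hTdef]; group, ?_⟩
  have hdiag : (fun i => (T : Matrix n n ℂ) i i) = d := funext fun i => by rw [hT, diagonal_apply_eq]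
  rw [hdiag]
  have h2 : V * star V = 1 := Matrix.mem_unitaryGroup_iff.mp hV
  calc (W : Matrix n n ℂ) = (V * star V) * (W : Matrix n n ℂ) * (V * star V) := by rw [h2, Matrix.one_mul, Matrix.mul_one]
    _ = V * (star V * (W : Matrix n n ℂ) * V) * star V := by simp only [Matrix.mul_assoc]
    _ = V * diagonal d * star V := by rw [hd]

/-- **`J⁻¹(B)` as a continuous image, `U(N)`.** -/
theorem preimage_eq_image_conj_of_spectral_unitary {β : Type*} {JD : (n → ℂ) → β}
    {J : Matrix.unitaryGroup n ℂ → β}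
    (hJspec : ∀ (W : Matrix.unitaryGroup n ℂ) (V : Matrix n n ℂ) (d : n → ℂ),
      V ∈ Matrix.unitaryGroup n ℂ → (W : Matrix n n ℂ) = V * diagonal d * star V → J W = JD d)
    (B : Set β) :
    J ⁻¹' B = (fun p : Matrix.unitaryGroup n ℂ × Matrix.unitaryGroup n ℂ => p.1 * p.2 * p.1⁻¹) ''
      {p | (∀ i j, i ≠ j → ((p.2 : Matrix.unitaryGroup n ℂ) : Matrix n n ℂ) i j = 0) ∧
        JD (fun i => ((p.2 : Matrix.unitaryGroup n ℂ) : Matrix n n ℂ) i i) ∈ B} := by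
  ext W
  constructor
  · intro hW
    obtain ⟨V, T, hT, hWVT, hWd⟩ := exists_unitary_conj_diagonal W
    refine ⟨(V, T), ⟨hT, ?_⟩, hWVT.symm⟩
    show JD (fun i => (T : Matrix n n ℂ) i i) ∈ B
    rw [← hJspec W V _ V.2 hWd]
    exact hW
  · rintro ⟨⟨V, T⟩, ⟨hT, hB⟩, rfl⟩
    show J (V * T * V⁻¹) ∈ B
    have hcoe : (((V * T * V⁻¹ : Matrix.unitaryGroup n ℂ)) : Matrix n n ℂ) =
        (V : Matrix n n ℂ) * diagonal (fun i => (T : Matrix n n ℂ) i i) * star (V : Matrix n n ℂ) := by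
      rw [← coe_eq_diagonal_of_offDiag_eq_zero hT]
      rfl
    rw [hJspec _ _ _ V.2 hcoe]
    exact hB

/-- **Measurability of a spectral density on `U(N)`.**  `J : U(N) → β` with `J W = JD d` in every
unitary diagonalization, `JD` measurable ⇒ `J` measurable.  (Removes `hJm` from
`hasJacobian_spectralKernel_unitaryGroup_of_torusJacobian`.) -/
theorem measurable_of_spectral_unitary {β : Type*} [MeasurableSpace β] {JD : (n → ℂ) → β} (hJDm : Measurable JD)
    {J : Matrix.unitaryGroup n ℂ → β}
    (hJspec : ∀ (W : Matrix.unitaryGroup n ℂ) (V : Matrix n n ℂ) (d : n → ℂ),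
      V ∈ Matrix.unitaryGroup n ℂ → (W : Matrix n n ℂ) = V * diagonal d * star V → J W = JD d) :
    Measurable J := by
  -- `U(N)`, a compact subset of the matrices, is Polish (kept local: no instance is declared here)
  haveI : PolishSpace (Matrix.unitaryGroup n ℂ) :=
    (IsClosed.isClosedEmbedding_subtypeVal (isCompact_iff_compactSpace.mpr
      (inferInstance : CompactSpace (Matrix.unitaryGroup n ℂ))).isClosed).polishSpace
  haveI : SecondCountableTopology (Matrix n n ℂ) := inferInstanceAs (SecondCountableTopology (n → n → ℂ))
  haveI : SecondCountableTopology (Matrix.unitaryGroup n ℂ) :=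
    Topology.IsEmbedding.subtypeVal.secondCountableTopology
  intro B hB
  have hΨ : Continuous fun p : Matrix.unitaryGroup n ℂ × Matrix.unitaryGroup n ℂ => p.1 * p.2 * p.1⁻¹ :=
    (continuous_fst.mul continuous_snd).mul continuous_fst.inv
  have hentry : ∀ i j, Continuous fun p : Matrix.unitaryGroup n ℂ × Matrix.unitaryGroup n ℂ =>
      ((p.2 : Matrix.unitaryGroup n ℂ) : Matrix n n ℂ) i j := fun i j => by
    have h1 : Continuous fun p : Matrix.unitaryGroup n ℂ × Matrix.unitaryGroup n ℂ =>
        ((p.2 : Matrix.unitaryGroup n ℂ) : Matrix n n ℂ) := continuous_subtype_val.comp continuous_snd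
    exact (continuous_apply j).comp ((continuous_apply i).comp h1)
  have hS : ∀ C : Set β, MeasurableSet C → MeasurableSet
      {p : Matrix.unitaryGroup n ℂ × Matrix.unitaryGroup n ℂ |
        (∀ i j, i ≠ j → ((p.2 : Matrix.unitaryGroup n ℂ) : Matrix n n ℂ) i j = 0) ∧
          JD (fun i => ((p.2 : Matrix.unitaryGroup n ℂ) : Matrix n n ℂ) i i) ∈ C} := by
    intro C hC
    have hdiag : MeasurableSet {p : Matrix.unitaryGroup n ℂ × Matrix.unitaryGroup n ℂ |
        ∀ i j, i ≠ j → ((p.2 : Matrix.unitaryGroup n ℂ) : Matrix n n ℂ) i j = 0} := by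
      have hset : {p : Matrix.unitaryGroup n ℂ × Matrix.unitaryGroup n ℂ |
          ∀ i j, i ≠ j → ((p.2 : Matrix.unitaryGroup n ℂ) : Matrix n n ℂ) i j = 0} =
          ⋂ i, ⋂ j, {p | i ≠ j → ((p.2 : Matrix.unitaryGroup n ℂ) : Matrix n n ℂ) i j = 0} := by
        ext p
        simp only [mem_setOf_eq, mem_iInter]
      rw [hset]
      refine MeasurableSet.iInter fun i => MeasurableSet.iInter fun j => ?_
      by_cases hij : i = j
      · have h0 : {p : Matrix.unitaryGroup n ℂ × Matrix.unitaryGroup n ℂ |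
            i ≠ j → ((p.2 : Matrix.unitaryGroup n ℂ) : Matrix n n ℂ) i j = 0} = univ := by
          ext p
          simp [hij]
        rw [h0]
        exact MeasurableSet.univ
      · have h0 : {p : Matrix.unitaryGroup n ℂ × Matrix.unitaryGroup n ℂ |
            i ≠ j → ((p.2 : Matrix.unitaryGroup n ℂ) : Matrix n n ℂ) i j = 0} =
            {p | ((p.2 : Matrix.unitaryGroup n ℂ) : Matrix n n ℂ) i j = 0} := by
          ext p
          simp [hij]
        rw [h0]
        exact (isClosed_eq (hentry i j) continuous_const).measurableSet
    rw [setOf_and]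
    exact hdiag.inter ((hJDm.comp (measurable_pi_lambda _ fun i => (hentry i i).measurable)) hC)
  have hA : ∀ C : Set β, MeasurableSet C → AnalyticSet (J ⁻¹' C) := fun C hC => by
    rw [preimage_eq_image_conj_of_spectral_unitary hJspec C]
    exact (hS C hC).analyticSet_image hΨ.measurable
  exact (hA B hB).measurableSet_of_compl (by rw [← preimage_compl]; exact hA Bᶜ hB.compl)

end Unitary

end Summit.Ventures.LatticeQCDFlow.Exactness

/-! ## The spectral hypothesis need only be checked on `SU(N)` conjugators (GEN-13 append)

In `measurable_of_spectral` the hypothesis `hJspec` quantifies over ALL unitary conjugators `V`.  A booked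
density of the engine's `SU(N)` spectral kernel is naturally a class function for the GAUGE group `SU(N)`, i.e.
the hypothesis one actually has quantifies over `V ∈ SU(N)` only.  The two are equivalent, by a phase: if `V` is
unitary, `c • V ∈ SU(N)` for a complex number `c` with `|c| = 1` and `c^N · det V = 1` (an `N`-th root built from
`Complex.log`), and `c • V` conjugates every matrix exactly as `V` does.

* `exists_specialUnitary_conj_eq_unitary_conj` — that reduction;
* `spectralHyp_unitary_of_su` — the `SU(N)`-conjugator form of the spectral hypothesis implies the unitary form;
* **`measurable_of_spectral_su`** — `measurable_of_spectral` under the `SU(N)`-conjugator hypothesis.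
-/

namespace Summit.Ventures.LatticeQCDFlow.Exactness

open MeasureTheory Matrix Set

variable {n : Type} [Fintype n] [DecidableEq n]

/-- **Unitary conjugators reduce to special-unitary ones.**  If `V` is unitary then some `V' ∈ SU(N)` conjugates
every matrix to the same result, `V'·D·V'⋆ = V·D·V⋆`: rescale `V` by a phase `c` with `c^N · det V = 1`. -/
theorem exists_specialUnitary_conj_eq_unitary_conj {V : Matrix n n ℂ} (hV : V ∈ Matrix.unitaryGroup n ℂ) :
    ∃ V' : Matrix n n ℂ, V' ∈ Matrix.specialUnitaryGroup n ℂ ∧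
      ∀ D : Matrix n n ℂ, V' * D * star V' = V * D * star V := by
  classical
  obtain hN | hN := Nat.eq_zero_or_pos (Fintype.card n)
  · haveI : IsEmpty n := Fintype.card_eq_zero_iff.mp hN
    exact ⟨V, Matrix.mem_specialUnitaryGroup_iff.mpr ⟨hV, Matrix.det_isEmpty⟩, fun D => rfl⟩
  · have hδu : V.det ∈ unitary ℂ := Matrix.det_of_mem_unitary hV
    have hδ1 : ‖V.det‖ = 1 := CStarRing.norm_coe_unitary ⟨V.det, hδu⟩
    have hδ0 : V.det ≠ 0 := fun h => by rw [h, norm_zero] at hδ1; exact zero_ne_one hδ1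
    obtain ⟨c, hc⟩ : ∃ c : ℂ, c = Complex.exp (-(Complex.log V.det / (Fintype.card n : ℂ))) := ⟨_, rfl⟩
    have hc1 : ‖c‖ = 1 := by
      rw [hc, Complex.norm_exp, Complex.neg_re, Complex.div_natCast_re, Complex.log_re, hδ1, Real.log_one,
        zero_div, neg_zero, Real.exp_zero]
    have hcN : c ^ Fintype.card n * V.det = 1 := by
      rw [hc, ← Complex.exp_nat_mul, mul_neg, mul_div_cancel₀ _ (Nat.cast_ne_zero.mpr hN.ne'), Complex.exp_neg,
        Complex.exp_log hδ0, inv_mul_cancel₀ hδ0]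
    have hcc : c * star c = 1 := by
      rw [Complex.star_def, Complex.mul_conj, Complex.normSq_eq_norm_sq, hc1, one_pow, Complex.ofReal_one]
    have hconj : ∀ D : Matrix n n ℂ, (c • V) * D * star (c • V) = V * D * star V := fun D => by
      rw [star_smul, Matrix.smul_mul, Matrix.smul_mul, Matrix.mul_smul, smul_smul, hcc, one_smul]
    refine ⟨c • V, Matrix.mem_specialUnitaryGroup_iff.mpr ⟨?_, ?_⟩, hconj⟩
    · rw [Matrix.mem_unitaryGroup_iff]
      have h := hconj 1
      rw [Matrix.mul_one, Matrix.mul_one] at h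
      rw [h]
      exact Matrix.mem_unitaryGroup_iff.mp hV
    · rw [Matrix.det_smul, hcN]

/-- **The `SU(N)`-conjugator form of the spectral hypothesis implies the unitary form.**  If `J W = JD d`
whenever `W = V·diag d·V⋆` with `V ∈ SU(N)`, then the same holds for every unitary `V`. -/
theorem spectralHyp_unitary_of_su {β : Type*} {JD : (n → ℂ) → β} {J : Matrix.specialUnitaryGroup n ℂ → β}
    (hJspec : ∀ (W : Matrix.specialUnitaryGroup n ℂ) (V : Matrix n n ℂ) (d : n → ℂ),
      V ∈ Matrix.specialUnitaryGroup n ℂ → (W : Matrix n n ℂ) = V * diagonal d * star V → J W = JD d)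
    (W : Matrix.specialUnitaryGroup n ℂ) (V : Matrix n n ℂ) (d : n → ℂ)
    (hV : V ∈ Matrix.unitaryGroup n ℂ) (hW : (W : Matrix n n ℂ) = V * diagonal d * star V) : J W = JD d := by
  obtain ⟨V', hV', hconj⟩ := exists_specialUnitary_conj_eq_unitary_conj hV
  exact hJspec W V' d hV' (hW.trans (hconj (diagonal d)).symm)

/-- **Measurability of a spectral density, the spectral hypothesis checked on `SU(N)` conjugators only.**
Let `J : SU(N) → β` satisfy `J W = JD d` whenever `W = V·diag d·V⋆` with `V ∈ SU(N)`, for a measurable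
`JD : (n → ℂ) → β`.  Then `J` is measurable. -/
theorem measurable_of_spectral_su {β : Type*} [MeasurableSpace β] {JD : (n → ℂ) → β} (hJDm : Measurable JD)
    {J : Matrix.specialUnitaryGroup n ℂ → β}
    (hJspec : ∀ (W : Matrix.specialUnitaryGroup n ℂ) (V : Matrix n n ℂ) (d : n → ℂ),
      V ∈ Matrix.specialUnitaryGroup n ℂ → (W : Matrix n n ℂ) = V * diagonal d * star V → J W = JD d) :
    Measurable J :=
  measurable_of_spectral hJDm (spectralHyp_unitary_of_su hJspec)

/-! ## Spectral densities are class functions by construction -/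

section ClassFunction

/-- **A spectral density is a class function on `SU(N)`.**  If `J W = JD d` in every unitary
diagonalization `W = V·diag d·V⋆` (`hJspec`, the booked-density hypothesis of every
`hasJacobian_spectralKernel_…` theorem), then `J (X W X⁻¹) = J W` for all `X, W ∈ SU(N)`: `X·V`
diagonalizes `X W X⁻¹` with the same spectrum.  No Jacobian identity and no measurability enter
(compare `ConjugationEquivariantKernelJacobian.ae_conjInvariant_jacobian_spectralKernel_sun`, which
derives the a.e. statement for ANY exact Jacobian from `HasJacobian`). -/
theorem conjInvariant_of_spectral {β : Type*} {JD : (n → ℂ) → β} {J : Matrix.specialUnitaryGroup n ℂ → β}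
    (hJspec : ∀ (W : Matrix.specialUnitaryGroup n ℂ) (V : Matrix n n ℂ) (d : n → ℂ),
      V ∈ Matrix.unitaryGroup n ℂ → (W : Matrix n n ℂ) = V * diagonal d * star V → J W = JD d)
    (X W : Matrix.specialUnitaryGroup n ℂ) : J (X * W * X⁻¹) = J W := by
  obtain ⟨V, T, -, -, hW⟩ := exists_specialUnitary_conj_diagonal W
  have hVu : (V : Matrix n n ℂ) ∈ Matrix.unitaryGroup n ℂ := (Matrix.mem_specialUnitaryGroup_iff.mp V.2).1
  have hXu : (X : Matrix n n ℂ) ∈ Matrix.unitaryGroup n ℂ := (Matrix.mem_specialUnitaryGroup_iff.mp X.2).1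
  have hXV : (X : Matrix n n ℂ) * V ∈ Matrix.unitaryGroup n ℂ := mul_mem hXu hVu
  have h2 : ((X * W * X⁻¹ : Matrix.specialUnitaryGroup n ℂ) : Matrix n n ℂ) =
      (X : Matrix n n ℂ) * V * diagonal (fun i => (T : Matrix n n ℂ) i i) * star ((X : Matrix n n ℂ) * V) := by
    rw [star_mul, show ((X * W * X⁻¹ : Matrix.specialUnitaryGroup n ℂ) : Matrix n n ℂ) =
      (X : Matrix n n ℂ) * (W : Matrix n n ℂ) * star (X : Matrix n n ℂ) from rfl, hW]
    simp only [Matrix.mul_assoc]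
  rw [hJspec _ _ _ hXV h2, hJspec W V _ hVu hW]

/-- **… hence invariant under every special-unitary change of diagonalization frame**: the value of a
spectral density does not depend on WHICH `SU(N)` matrix conjugates `W` (the engine canonicalises
eigenvalue ORDER only; the frame is never booked). -/
theorem spectral_apply_conj_eq_of_conj_eq {β : Type*} {JD : (n → ℂ) → β} {J : Matrix.specialUnitaryGroup n ℂ → β}
    (hJspec : ∀ (W : Matrix.specialUnitaryGroup n ℂ) (V : Matrix n n ℂ) (d : n → ℂ),
      V ∈ Matrix.unitaryGroup n ℂ → (W : Matrix n n ℂ) = V * diagonal d * star V → J W = JD d)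
    (X Y W : Matrix.specialUnitaryGroup n ℂ) : J (X * W * X⁻¹) = J (Y * W * Y⁻¹) := by
  rw [conjInvariant_of_spectral hJspec, conjInvariant_of_spectral hJspec]

end ClassFunction

end Summit.Ventures.LatticeQCDFlow.Exactness
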